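import Summits.ABC.IUTFork.Cor312TeamAHonestCensus
import Summits.ABC.IUTFork.Cor312TeamAGapWitnessNV
import HarnessLib

/-!
# [IUTchIII] Cor. 3.12 — (G3) for the honest census's hypothesis list at the CONTENTFUL witness

Record-only, proof-only companion (D-0012) of `Cor312TeamAHonestCensus.lean` (p418084, abc-iut-w4-d021): the
non-derivability of the gap from the EXACT eight non-gap hypotheses of `Cor312Proof.teamA_statement_honest_of_thm311`,
re-run at A2's STRONG-CONTENTFUL witness `Cor312Vol.GapWitnessNV.nvSetting` (Cor312TeamAGapWitnessNV.lean p414526: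
typed Thm 3.11 in full with NONEMPTY splitting monoid, PROPER (Ind3) shell, non-identity Kummer transport), next to
the degenerate-class transfer `honestCensus_premises_not_imp_gap` of the parent file. S. Mochizuki, *Inter-universal
Teichmüller theory III*, Cor. 3.12, Step (xi-f) p. 184 l. 19–29 [cite: Mochizuki2012, III Cor 3.12 p.184]; claim key
DISPUTED (D-0012). plan/ADJUDICATION-SPEC.md §2 (G3) grading: the volume engine is the same two-valued `gapVol` as the
degenerate family (ref-b B11-4: ONE family), upgraded by the content clauses. TAKES NO SIDE; typed ≠ proved.
-/

namespace Summit.ABC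

namespace IUTFork

namespace Cor312Proof

open Locus Obs Thm311 Cor312 Cor312Vol StepXI Literature.IUT.LogThetaLattice

/-- The two-valued log-volume `gapVol` of the toy packets (shared by Team A's gap witness and by A2's contentful
witness) is invariant under EVERY `ℚ`-linear automorphism of the packet (`A ⊆ {0}` iff `e '' A ⊆ {0}`).
[folklore] -/
theorem gapVol_image_linearEquiv {j : Cor312.Checks.toyIndex.Label} {vQ : Cor312.Checks.toyIndex.VQ}
    (e : Cor312.Checks.toyShells.Packet j vQ ≃ₗ[ℚ] Cor312.Checks.toyShells.Packet j vQ)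
    (A : Set (Cor312.Checks.toyShells.Packet j vQ)) :
    GapWitness.gapVol j vQ (e '' A) = GapWitness.gapVol j vQ A := by
  have key : (⇑e '' A ⊆ ({0} : Set _)) ↔ A ⊆ ({0} : Set _) := by
    constructor
    · intro h x hx
      have hx0 : e x ∈ ({0} : Set _) := h ⟨x, hx, rfl⟩
      rw [Set.mem_singleton_iff] at hx0 ⊢
      exact e.injective (by rw [hx0, map_zero])
    · rintro h _ ⟨x, hx, rfl⟩
      rw [Set.mem_singleton_iff, Set.mem_singleton_iff.mp (h hx), map_zero]
  by_cases hA : A ⊆ ({0} : Set _)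
  · rw [GapWitness.gapVol_of_subset hA, GapWitness.gapVol_of_subset (key.mpr hA)]
  · rw [GapWitness.gapVol_of_not_subset hA, GapWitness.gapVol_of_not_subset (mt key.mp hA)]

/-- Log-volume invariance under the (Ind1)/(Ind2) families at A2's CONTENTFUL witness data (`GapWitnessNV.nvData`:
same `gapVol`, nonempty splitting monoid `{0}`, proper `zShell`). [folklore] -/
theorem nvData_logvolInvariant : GapWitnessNV.nvData.LogvolInvariant :=
  fun Φ _ j vQ A _ => gapVol_image_linearEquiv (Φ j vQ) A

/-- **(G3) for the honest census's EXACT hypothesis list, STRONG-CONTENTFUL class** (A2's witness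
`GapWitnessNV.nvSetting` over `nvFull`, p414526: typed Thm 3.11 IN FULL with NONEMPTY splitting monoid, PROPER
(Ind3) shell, non-identity Kummer transport): all of {F.Statement, BridgeHyps, (Ind1)(Ind2) admissibility transport,
log-volume invariance, monotone log-volume, Kummer-(a) of the setting's own column, strip-isomorphism slot filled,
`|log(q)| > 0`, a strip-algorithm presentation} hold — and `GapGlobal` FAILS for every strip algorithm. A second, distinct
mechanism from `honestCensus_premises_not_imp_gap` only in its contentfulness clauses (the volume engine is the same
two-valued `gapVol`; ref-b B11-4's caution applies: count the two as ONE degenerate-volume family, upgraded by the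
content clauses). [claim: Mochizuki2012, status: disputed] -/
theorem honestCensus_premises_not_imp_gap_contentful :
    ∃ (T : ThetaIndex) (F : FullSituation T) (Q : Cor312.Setting F.toSituation)
      (D : ThetaLinkStrips Q.LogLink Q.Strip),
      F.Statement ∧ BridgeHyps Q ∧
      (∀ Φ ∈ F.L.Ind1Family ∪ F.L.Ind2Family, ∀ (j : T.Label) (vQ : T.VQ) (X : Set (F.L.Packet j vQ)),
        (F.D Q.n).Adm j vQ X ↔ (F.D Q.n).Adm j vQ (Φ j vQ '' X)) ∧
      (F.D Q.n).LogvolInvariant ∧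
      (∀ (j : T.Label) (vQ : T.VQ) (X Y : Set (F.L.Packet j vQ)),
        (F.D Q.n).Adm j vQ X → (F.D Q.n).Adm j vQ Y → X ⊆ Y → (F.D Q.n).logvol j vQ X ≤ (F.D Q.n).logvol j vQ Y) ∧
      (F.col Q.n).KummerA (F.D Q.n) ∧
      (∀ n m : ℤ, Nonempty (Q.IsoS (D.stripLGP (Q.lattice.logLink n (m - 1)))
        (D.stripDelta (Q.lattice.theater (n + 1) m)))) ∧
      Q.AbsLogQPos ∧ Nonempty (InputStrip.StripAlgorithm Q) ∧
      (∀ A : InputStrip.StripAlgorithm Q, ¬ A.GapGlobal) ∧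
      (∀ (v : T.V) (hv : v ∈ T.Vbad), ((F.D 0).Ψ v hv).Nonempty) ∧
      ∀ (j : T.Label) (vQ : T.VQ), (F.D 0).shellPk j vQ ≠ Set.univ :=
  ⟨Cor312.Checks.toyIndex, GapWitnessNV.nvFull, GapWitnessNV.nvSetting,
    ⟨fun _ => (), fun _ => (), fun _ => ()⟩,
    GapWitnessNV.nvFull_statement, GapWitnessNV.nvSetting_bridgeHyps,
    fun _ _ _ _ _ => Iff.rfl, nvData_logvolInvariant,
    fun _ _ _ _ _ _ h => GapWitness.gapData_logvol_mono h,
    (GapWitnessNV.nv_partII _).1, fun _ _ => ⟨()⟩, GapWitnessNV.nvSetting_absLogQPos,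
    ⟨InputStrip.StripAlgorithm.canonical _⟩,
    InputStrip.not_gapGlobal_of_not_statement GapWitnessNV.nvSetting_bridgeHyps
      GapWitnessNV.nvSetting_not_statement,
    fun _ _ => ⟨0, rfl⟩, fun j vQ => GapWitnessNV.zShell_ne_univ j vQ⟩

end Cor312Proof

end IUTFork

end Summit.ABC
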